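import Mathlib
import Summits.MatrixMultiplication.MatrixMultiplication.Theorems.SnSubsetDichotomyNoThresholdSubsetTriplePlancherelStepDefs
import Literature.NumberTheory.DiophantineGeometry.PartitionTableauxProofs

/-!
# The transition probability is the ratio of standard-tableau counts (route `SnSubsetDichotomy`, crux `NoThresholdSubsetTriple`)

Stub `transProb_mul_card_stdFilling` (model theorem, half 1) of line `klr-graded-polynomial-method`
(stmt-MatrixMultiplication-8302).

For a Young diagram `Y` with `n` cells, an addable node `y = (a, b)` of `Y` and the Young diagram `Y'`
with cells `Y ∪ {y}`, the hook-product transition probability `p_y` (`PlancherelStep.transProb`)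
satisfies `p_y · (n + 1) · f^Y = f^{Y'}`, where `f` is the number of standard Young tableaux
(`StdFilling`).

Proof.  The hook length formula (Frame–Robinson–Thrall 1954, Theorem 1; tree:
`card_stdFilling_mul_prod_hookLength`) gives `f^Y · H(Y) = n!` and `f^{Y'} · H(Y') = (n + 1)!`, `H` the
product of the hook lengths.  At an addable node `(a, b)` row `a` of `Y` has length `b` and column `b`
has length `a`; adding the cell `(a, b)` raises by one exactly the hooks of the cells `(a, j)`, `j < b`,
and `(i, b)`, `i < a`, leaves every other hook of `Y` unchanged, and the new cell has hook `1`.  Hence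
`H(Y) = p_y · H(Y')` (`p_y = ∏_{j<b} h(a,j)/(h(a,j)+1) · ∏_{i<a} h(i,b)/(h(i,b)+1)`), and
`f^{Y'} · H(Y') = (n + 1) · f^Y · H(Y) = (n + 1) · f^Y · p_y · H(Y')`; cancel `H(Y') ≠ 0`.
-/

open scoped BigOperators
open Literature.RepresentationTheory.FiniteGroups (addableNodes IsAddableNode)
open Literature.NumberTheory.DiophantineGeometry (StdFilling hookLength)

namespace Summit.MatrixMultiplication.MatrixMultiplication.Theorems

open PlancherelStep

set_option linter.dupNamespace false in
/-- In a lower set, the row of an addable node `(a, b)` consists of the cells `(a, j)`, `j < b`. -/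
private theorem mem_row_iff_lt {ν : Finset (ℕ × ℕ)} (hν : IsLowerSet (ν : Set (ℕ × ℕ)))
    {a b : ℕ} (hy : IsAddableNode ν (a, b)) (j : ℕ) : (a, j) ∈ ν ↔ j < b := by
  -- adapted from `SnSubsetDichotomyNoThresholdSubsetTripleTransProbInsert` (same namespace, private)
  obtain ⟨hy₀, -, hy₂⟩ := hy
  dsimp only at hy₂
  refine ⟨fun h => ?_, fun hj => ?_⟩
  · by_contra hj
    exact hy₀ (Finset.mem_coe.1 (hν (Prod.mk_le_mk.2 ⟨le_rfl, not_lt.1 hj⟩) (Finset.mem_coe.2 h)))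
  · exact Finset.mem_coe.1 (hν (Prod.mk_le_mk.2 ⟨le_rfl, show j ≤ b - 1 by omega⟩)
      (Finset.mem_coe.2 (hy₂.resolve_left (by omega))))

set_option linter.dupNamespace false in
/-- In a lower set, the column of an addable node `(a, b)` consists of the cells `(i, b)`, `i < a`. -/
private theorem mem_col_iff_lt {ν : Finset (ℕ × ℕ)} (hν : IsLowerSet (ν : Set (ℕ × ℕ)))
    {a b : ℕ} (hy : IsAddableNode ν (a, b)) (i : ℕ) : (i, b) ∈ ν ↔ i < a := by
  obtain ⟨hy₀, hy₁, -⟩ := hy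
  dsimp only at hy₁
  refine ⟨fun h => ?_, fun hi => ?_⟩
  · by_contra hi
    exact hy₀ (Finset.mem_coe.1 (hν (Prod.mk_le_mk.2 ⟨not_lt.1 hi, le_rfl⟩) (Finset.mem_coe.2 h)))
  · exact Finset.mem_coe.1 (hν (Prod.mk_le_mk.2 ⟨show i ≤ a - 1 by omega, le_rfl⟩)
      (Finset.mem_coe.2 (hy₁.resolve_left (by omega))))

set_option linter.dupNamespace false in
/-- The row of an addable node `(a, b)` of a lower set is `{(a, j) : j < b}`. -/
private theorem row_filter_eq {ν : Finset (ℕ × ℕ)} (hν : IsLowerSet (ν : Set (ℕ × ℕ)))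
    {a b : ℕ} (hy : IsAddableNode ν (a, b)) :
    ν.filter (fun x => x.1 = a) = (Finset.range b).image fun j => (a, j) := by
  ext ⟨i, j⟩
  simp only [Finset.mem_filter, Finset.mem_image, Finset.mem_range, Prod.mk.injEq]
  refine ⟨?_, ?_⟩
  · rintro ⟨h, rfl⟩
    exact ⟨j, (mem_row_iff_lt hν hy j).1 h, rfl, rfl⟩
  · rintro ⟨k, hk, rfl, rfl⟩
    exact ⟨(mem_row_iff_lt hν hy k).2 hk, rfl⟩

set_option linter.dupNamespace false in
/-- The column of an addable node `(a, b)` of a lower set is `{(i, b) : i < a}`. -/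
private theorem col_filter_eq {ν : Finset (ℕ × ℕ)} (hν : IsLowerSet (ν : Set (ℕ × ℕ)))
    {a b : ℕ} (hy : IsAddableNode ν (a, b)) :
    ν.filter (fun x => x.2 = b) = (Finset.range a).image fun i => (i, b) := by
  ext ⟨i, j⟩
  simp only [Finset.mem_filter, Finset.mem_image, Finset.mem_range, Prod.mk.injEq]
  refine ⟨?_, ?_⟩
  · rintro ⟨h, rfl⟩
    exact ⟨i, (mem_col_iff_lt hν hy i).1 h, rfl, rfl⟩
  · rintro ⟨k, hk, rfl, rfl⟩
    exact ⟨(mem_col_iff_lt hν hy k).2 hk, rfl⟩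

set_option linter.dupNamespace false in
/-- Off row `a`, the column of an addable node `(a, b)` of a lower set is still `{(i, b) : i < a}`
(a cell of column `b` lies strictly above row `a`). -/
private theorem col_filter_eq' {ν : Finset (ℕ × ℕ)} (hν : IsLowerSet (ν : Set (ℕ × ℕ)))
    {a b : ℕ} (hy : IsAddableNode ν (a, b)) :
    (ν.filter fun x => ¬ x.1 = a).filter (fun x => x.2 = b) =
      (Finset.range a).image fun i => (i, b) := by
  ext ⟨i, j⟩
  simp only [Finset.mem_filter, Finset.mem_image, Finset.mem_range, Prod.mk.injEq]
  refine ⟨?_, ?_⟩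
  · rintro ⟨⟨h, -⟩, rfl⟩
    exact ⟨i, (mem_col_iff_lt hν hy i).1 h, rfl, rfl⟩
  · rintro ⟨k, hk, rfl, rfl⟩
    exact ⟨⟨(mem_col_iff_lt hν hy k).2 hk, hk.ne⟩, rfl⟩

set_option linter.dupNamespace false in
/-- The row of an addable node `(a, b)` of a lower set has length `b`. -/
private theorem rowLen_eq_of_addable {ν : Finset (ℕ × ℕ)} (hν : IsLowerSet (ν : Set (ℕ × ℕ)))
    {a b : ℕ} (hy : IsAddableNode ν (a, b)) : rowLen ν a = b := by
  rw [rowLen, row_filter_eq hν hy, Finset.card_image_of_injective _ (Prod.mk_right_injective a),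
    Finset.card_range]

set_option linter.dupNamespace false in
/-- The column of an addable node `(a, b)` of a lower set has length `a`. -/
private theorem colLen_eq_of_addable {ν : Finset (ℕ × ℕ)} (hν : IsLowerSet (ν : Set (ℕ × ℕ)))
    {a b : ℕ} (hy : IsAddableNode ν (a, b)) : colLen ν b = a := by
  rw [colLen, col_filter_eq hν hy, Finset.card_image_of_injective _ (Prod.mk_left_injective b),
    Finset.card_range]

set_option linter.dupNamespace false in
/-- Inserting a new cell `(r, c)` lengthens row `r` by one. -/
private theorem rowLen_insert_self {ν : Finset (ℕ × ℕ)} {r c : ℕ} (hz : (r, c) ∉ ν) :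
    rowLen (insert (r, c) ν) r = rowLen ν r + 1 := by
  rw [rowLen, rowLen, Finset.filter_insert, if_pos rfl, Finset.card_insert_of_notMem]
  exact fun h => hz (Finset.mem_filter.1 h).1

set_option linter.dupNamespace false in
/-- Inserting a cell `(r, c)` does not change the rows `i ≠ r`. -/
private theorem rowLen_insert_of_ne {ν : Finset (ℕ × ℕ)} {r c i : ℕ} (h : r ≠ i) :
    rowLen (insert (r, c) ν) i = rowLen ν i := by
  rw [rowLen, rowLen, Finset.filter_insert, if_neg h]

set_option linter.dupNamespace false in
/-- Inserting a new cell `(r, c)` lengthens column `c` by one. -/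
private theorem colLen_insert_self {ν : Finset (ℕ × ℕ)} {r c : ℕ} (hz : (r, c) ∉ ν) :
    colLen (insert (r, c) ν) c = colLen ν c + 1 := by
  rw [colLen, colLen, Finset.filter_insert, if_pos rfl, Finset.card_insert_of_notMem]
  exact fun h => hz (Finset.mem_filter.1 h).1

set_option linter.dupNamespace false in
/-- Inserting a cell `(r, c)` does not change the columns `j ≠ c`. -/
private theorem colLen_insert_of_ne {ν : Finset (ℕ × ℕ)} {r c j : ℕ} (h : c ≠ j) :
    colLen (insert (r, c) ν) j = colLen ν j := by
  rw [colLen, colLen, Finset.filter_insert, if_neg h]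

set_option linter.dupNamespace false in
/-- Inserting a cell in another row and another column does not change the hook of `(i, j)`. -/
private theorem hook_insert_of_ne {ν : Finset (ℕ × ℕ)} {r c i j : ℕ} (hi : r ≠ i) (hj : c ≠ j) :
    hook (insert (r, c) ν) (i, j) = hook ν (i, j) := by
  simp only [hook, rowLen_insert_of_ne hi, colLen_insert_of_ne hj]

set_option linter.dupNamespace false in
/-- The Literature hook length of a cell of a Young diagram (Mathlib `rowLen`/`colLen`) is the
`PlancherelStep` hook of its cell set (row/column lengths as filtered cardinalities). -/
private theorem hookLength_eq_hook (Y : YoungDiagram) (c : ℕ × ℕ) :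
    hookLength Y c = hook Y.cells c := by
  unfold hookLength hook
  rw [Y.rowLen_eq_card, Y.colLen_eq_card]
  rfl

set_option linter.dupNamespace false in
/-- Splitting a product over a lower set `ν` with addable node `(a, b)` into its row-`a` part
(cells `(a, j)`, `j < b`), its column-`b` part (cells `(i, b)`, `i < a`) and the rest. -/
private theorem prod_split {ν : Finset (ℕ × ℕ)} (hν : IsLowerSet (ν : Set (ℕ × ℕ))) {a b : ℕ}
    (hy : IsAddableNode ν (a, b)) (g : ℕ × ℕ → ℝ) :
    ∏ c ∈ ν, g c = (∏ j ∈ Finset.range b, g (a, j)) * ((∏ i ∈ Finset.range a, g (i, b)) *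
      ∏ c ∈ (ν.filter fun x => ¬ x.1 = a).filter (fun x => ¬ x.2 = b), g c) := by
  rw [← Finset.prod_filter_mul_prod_filter_not ν (fun x => x.1 = a),
    ← Finset.prod_filter_mul_prod_filter_not (ν.filter fun x => ¬ x.1 = a) (fun x => x.2 = b),
    row_filter_eq hν hy, col_filter_eq' hν hy, Finset.prod_image (Prod.mk_right_injective a).injOn,
    Finset.prod_image (Prod.mk_left_injective b).injOn]

set_option linter.dupNamespace false in
/-- `H(ν) = p_y · H(ν ∪ y)`: adding the addable node `y = (a, b)` to a lower set `ν` turns the hooks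
`h(a, j)`, `j < b`, and `h(i, b)`, `i < a`, into `h + 1`, keeps all other hooks of `ν`, and the new cell
has hook `1`; so the product of all hook lengths gets divided by the hook-product transition
probability `p_y`. -/
private theorem prod_hook_eq_transProb_mul {ν : Finset (ℕ × ℕ)} (hν : IsLowerSet (ν : Set (ℕ × ℕ)))
    {y : ℕ × ℕ} (hy : IsAddableNode ν y) :
    ((∏ c ∈ ν, hook ν c : ℕ) : ℝ) =
      transProb ν y * ((∏ c ∈ insert y ν, hook (insert y ν) c : ℕ) : ℝ) := by
  obtain ⟨a, b⟩ := y
  have hyν : ((a, b) : ℕ × ℕ) ∉ ν := hy.1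
  have hRa : rowLen ν a = b := rowLen_eq_of_addable hν hy
  have hCb : colLen ν b = a := colLen_eq_of_addable hν hy
  have hnew : hook (insert (a, b) ν) (a, b) = 1 := by
    simp only [hook, rowLen_insert_self hyν, colLen_insert_self hyν, hRa, hCb]
    omega
  have hrow : ∀ j ∈ Finset.range b, hook (insert (a, b) ν) (a, j) = hook ν (a, j) + 1 := by
    intro j hj
    have hjb : j < b := Finset.mem_range.1 hj
    simp only [hook, rowLen_insert_self hyν, colLen_insert_of_ne (show b ≠ j by omega), hRa]
    omega
  have hcol : ∀ i ∈ Finset.range a, hook (insert (a, b) ν) (i, b) = hook ν (i, b) + 1 := by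
    intro i hi
    have hia : i < a := Finset.mem_range.1 hi
    simp only [hook, rowLen_insert_of_ne (show a ≠ i by omega), colLen_insert_self hyν, hCb]
    omega
  have hoff : ∀ c ∈ (ν.filter fun x => ¬ x.1 = a).filter (fun x => ¬ x.2 = b),
      hook (insert (a, b) ν) c = hook ν c := by
    rintro ⟨i, j⟩ hc
    simp only [Finset.mem_filter] at hc
    exact hook_insert_of_ne (Ne.symm hc.1.2) (Ne.symm hc.2)
  have eA : ∏ j ∈ Finset.range b, ((hook (insert (a, b) ν) (a, j) : ℕ) : ℝ) =
      ∏ j ∈ Finset.range b, ((hook ν (a, j) : ℝ) + 1) :=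
    Finset.prod_congr rfl fun j hj => by rw [hrow j hj, Nat.cast_succ]
  have eB : ∏ i ∈ Finset.range a, ((hook (insert (a, b) ν) (i, b) : ℕ) : ℝ) =
      ∏ i ∈ Finset.range a, ((hook ν (i, b) : ℝ) + 1) :=
    Finset.prod_congr rfl fun i hi => by rw [hcol i hi, Nat.cast_succ]
  have eO : ∏ c ∈ (ν.filter fun x => ¬ x.1 = a).filter (fun x => ¬ x.2 = b),
        ((hook (insert (a, b) ν) c : ℕ) : ℝ) =
      ∏ c ∈ (ν.filter fun x => ¬ x.1 = a).filter (fun x => ¬ x.2 = b), ((hook ν c : ℕ) : ℝ) :=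
    Finset.prod_congr rfl fun c hc => by rw [hoff c hc]
  have kA : (∏ j ∈ Finset.range b, ((hook ν (a, j) : ℝ) / (hook ν (a, j) + 1))) *
      ∏ j ∈ Finset.range b, ((hook ν (a, j) : ℝ) + 1) = ∏ j ∈ Finset.range b, (hook ν (a, j) : ℝ) := by
    rw [← Finset.prod_mul_distrib]
    exact Finset.prod_congr rfl fun j _ => div_mul_cancel₀ _ (by positivity)
  have kB : (∏ i ∈ Finset.range a, ((hook ν (i, b) : ℝ) / (hook ν (i, b) + 1))) *
      ∏ i ∈ Finset.range a, ((hook ν (i, b) : ℝ) + 1) = ∏ i ∈ Finset.range a, (hook ν (i, b) : ℝ) := by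
    rw [← Finset.prod_mul_distrib]
    exact Finset.prod_congr rfl fun i _ => div_mul_cancel₀ _ (by positivity)
  have ht : transProb ν (a, b) = (∏ j ∈ Finset.range b, ((hook ν (a, j) : ℝ) / (hook ν (a, j) + 1))) *
      ∏ i ∈ Finset.range a, ((hook ν (i, b) : ℝ) / (hook ν (i, b) + 1)) := rfl
  rw [Finset.prod_insert hyν, hnew, one_mul, Nat.cast_prod, Nat.cast_prod,
    prod_split hν hy (fun c => ((hook ν c : ℕ) : ℝ)),
    prod_split hν hy (fun c => ((hook (insert (a, b) ν) c : ℕ) : ℝ)), eA, eB, eO, ← kA, ← kB, ht]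
  ring

set_option linter.dupNamespace false in
/-- **Model theorem, half 1: the hook-product transition probability is the ratio of the numbers of
standard Young tableaux.**  For a Young diagram `Y` with `n` cells, an addable node `y` of `Y` and the
Young diagram `Y'` with cells `Y ∪ {y}`: `p_y · (n + 1) · f^Y = f^{Y'}`, `f` = number of standard Young
tableaux (`StdFilling`), `p_y` = `PlancherelStep.transProb` (hook-product form).  From the hook length
formula `f^Y · ∏ hooks = n!` (Frame–Robinson–Thrall 1954, Theorem 1;
`card_stdFilling_mul_prod_hookLength`) and `∏ hooks(Y) = p_y · ∏ hooks(Y')`. [folklore] -/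
theorem transProb_mul_card_stdFilling : ∀ (Y Y' : YoungDiagram) (y : ℕ × ℕ),
    y ∈ addableNodes Y.cells → Y'.cells = insert y Y.cells →
      transProb Y.cells y * ((((Y.cells.card + 1 : ℕ) : ℝ)) * (Nat.card (StdFilling Y.cells.card Y) : ℝ)) =
        (Nat.card (StdFilling (Y.cells.card + 1) Y') : ℝ) := by
  intro Y Y' y hy hY'
  rw [Literature.RepresentationTheory.FiniteGroups.mem_addableNodes] at hy
  have hcard : Y'.cells.card = Y.cells.card + 1 := by
    rw [hY', Finset.card_insert_of_notMem hy.1]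
  have hF := Literature.NumberTheory.DiophantineGeometry.card_stdFilling_mul_prod_hookLength Y rfl
  have hF' :=
    Literature.NumberTheory.DiophantineGeometry.card_stdFilling_mul_prod_hookLength Y' hcard
  have hkey : ((∏ c ∈ Y.cells, hookLength Y c : ℕ) : ℝ) =
      transProb Y.cells y * ((∏ c ∈ Y'.cells, hookLength Y' c : ℕ) : ℝ) := by
    simp_rw [hookLength_eq_hook, hY']
    exact prod_hook_eq_transProb_mul Y.isLowerSet hy
  have hH' : ((∏ c ∈ Y'.cells, hookLength Y' c : ℕ) : ℝ) ≠ 0 := by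
    rw [Nat.cast_ne_zero]
    exact Finset.prod_ne_zero_iff.2 fun c hc => by
      have := Literature.NumberTheory.DiophantineGeometry.one_le_hookLength hc
      omega
  have hnat : Nat.card (StdFilling (Y.cells.card + 1) Y') * ∏ c ∈ Y'.cells, hookLength Y' c =
      (Y.cells.card + 1) * (Nat.card (StdFilling Y.cells.card Y) * ∏ c ∈ Y.cells, hookLength Y c) := by
    rw [hF', hF, Nat.factorial_succ]
  have e1 : (Nat.card (StdFilling (Y.cells.card + 1) Y') : ℝ) *
      ((∏ c ∈ Y'.cells, hookLength Y' c : ℕ) : ℝ) =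
      ((Y.cells.card + 1 : ℕ) : ℝ) * ((Nat.card (StdFilling Y.cells.card Y) : ℝ) *
        ((∏ c ∈ Y.cells, hookLength Y c : ℕ) : ℝ)) := by
    exact_mod_cast hnat
  refine mul_right_cancel₀ hH' ?_
  rw [e1, hkey]
  ring

end Summit.MatrixMultiplication.MatrixMultiplication.Theorems
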